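import Literature.AlgebraicGeometry.Motives.HodgeStructureLefschetzGroupFiniteDirectSumPoints
import Literature.AlgebraicGeometry.Motives.HodgeStructureLefschetzGroupFiniteDirectSum
import Literature.AlgebraicGeometry.Motives.HodgeStructureEndAlgCentralizerUnitaryGeneration
import HarnessLib

/-!
# Milne 1999, Proposition 1.1 ON `K`-POINTS for the ALGEBRA `C(A)`: `C(⊕_j H_j)(K) ⊆ Π_j C(H_j)(K)` block-diagonally,
# `C(⊕_j H_j)(K) ≃ₐ[K] Π_j C(H_j)(K)` for a `Hom`-orthogonal family and `C(H₀^{⊕ι})(K) ≃ₐ[K] C(H₀)(K)`, as algebras WITH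
# INVOLUTION — and "the `k`-algebra `C(A)` is generated by the `γ ∈ S(A)(k)`" passes to such sums and powers

[topic AlgebraicGeometry/Motives]

Layer `Literature/AlgebraicGeometry/Motives`, lane `lit-hodgefound` (Track 2 foundations library; seat `lit-hodgefound-p34`,
generation 24, self-proposed row g24-#2), namespace `Literature.AlgebraicGeometry.Motives.HodgeStructure`. The `K`-POINTS
companion, for the ALGEBRA `C(A) ⊗ K` with its involution, of the seat's g21-#2 `Motives/HodgeStructureLefschetzGroupFiniteDirectSum`
(`centralizerPiAlgEquiv`, `centralizerPiConstAlgEquiv`, `adjoint_pi_piDiag`: the case `K = ℚ`) and of its FILE 2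
`Motives/HodgeStructureLefschetzGroupFiniteDirectSumPoints` (the GROUPS `S(⊕_j H_j)(K)`, `S(H₀^{⊕ι})(K)`), closing the free pointer
"(f) `K`-points centralizer of finite sums" of the seat sheet; and the REDUCTION STEP of Milne's proof of Lemma 3.5 ("Each pair
`(R, †)` is a product of pairs …") for the sentence "the `k`-algebra `C(A)` is generated by the `γ ∈ S(A)(k)`" (p. 653), which the
seat proved summand by summand (g23-#5 `Motives/HodgeStructureEndAlgCentralizerUnitaryGeneration`: type IV pairs case; g24-#1
`Motives/HodgeStructureEndAlgCentralizerTwistedBlocks`: types I/II/III): here it is shown to pass to `Hom`-orthogonal finite direct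
sums and to powers, i.e. along an isogeny decomposition `A ~ ∏ᵢ Aᵢ^{rᵢ}` (Proposition 1.1). DEFINITIONS WITH BODIES
(`piBlockDiagEnd`, `piBlockDiagEndAlgHom`, `centralizerBaseChangePiAlgEquiv`, `centralizerBaseChangePiConstAlgEquiv`) + THEOREMS;
no named fact, no `sorry` (D-0026, net debt `0`).

## The source, verbatim

J. S. Milne, *Lefschetz classes on abelian varieties*, Duke Math. J. **96** (1999) 639–675 [Milne1999LefschetzClasses] (held
text `paper:doi-10-1215-s0012-7094-99-09620-5`; p0005 = p. 643, p0006 = p. 644, p0015 = p. 653):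
* (§1 p. 643 L12–L16) "For any positive integer `r`, `V(A^r) = rV(A)`, and the diagonal action of `C(A)` on `rV(A)` identifies
  `C(A)` with `C(A^r)` (as `k`-algebras with involution). Let `A = A₁ × ⋯ × A_s`. Then `C(A) ⊂ C(A₁) × ⋯ × C(A_s)`, with
  equality holding if and only if `Hom(Aᵢ, Aⱼ) = 0` for all `i, j`, `i ≠ j`."
* (§1 p. 643 L16–L24) "Moreover, if `Dᵢ` is an ample divisor on `Aᵢ`, `i = 1, …, s`, then `D = Σᵢ A₁ × ⋯ × A_{i−1} × Dᵢ ×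
  A_{i+1} × ⋯ × A_s` is an ample divisor on `A`, and the involution it defines on `C(A)` is the restriction of the product of the
  involutions on the `C(Aᵢ)` defined by the `Dᵢ`."
* (§1 p. 643 L27–L31) "**Proposition 1.1.** Let `A₁, …, A_s` be a set of representatives for the simple isogeny factors of `A`, so
  that there exists an isogeny `A₁^{r₁} × ⋯ × A_s^{r_s} → A` for some `rᵢ > 0`. Any such isogeny induces an isomorphism
  `C(A₁) × ⋯ × C(A_s) → C(A)` of `k`-algebras with involution, which is independent of the choice of the isogeny."
* (§1 p. 644 L18) "`S(A)(R) = {γ ∈ C(A) ⊗_k R | γ†γ = 1}`" (so `C(A)`, `S(A)` are read on `R`-points: Remark 1.6).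
* (§3 p. 653 L42–L46 and L47–L49) "The next lemma shows that the `k`-algebra `C(A)` is generated by the `γ ∈ S(A)(k)` […]
  **Lemma 3.5.** Any semisimple algebra with involution `(R, †)` of finite dimension over an algebraically closed field `k` is
  generated (as a `k`-algebra) by the subset `U` of elements `u` satisfying `u†u = 1`. *Proof.* Each pair `(R, †)` is a product
  of pairs of the following types […] We may assume `(R, †)` is one of the above pairs."

## Dictionary

A finite family `H : Π j : ι, HodgeStructure (W j) n` with polarizations `Q j`, on the tree's direct sum `HodgeStructure.pi H`
(carrier `Π_j W_j`) polarized by `Polarization.pi Q` (`(⊕Q)((x_j),(y_j)) = Σ_j Q_j(x_j, y_j)`, `Motives/HodgeStructureDirectSum`);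
a field `K ⊇ ℚ`; `C(H)(K) := Subalgebra.centralizer K {a_K | a ∈ E_φ(H)} ⊆ End_K(K ⊗ V)` (Milne's `C(A) ⊗_k K` in the commutation
reading, as in all the seat's `K`-points files); the block calculus `(in_j)_K = (LinearMap.single ℚ W j).baseChange K`,
`(pr_j)_K = (LinearMap.proj j).baseChange K` of `Motives/MumfordTateGroupDiagonal` / `…LefschetzGroupFiniteDirectSumPoints`; the
involution `c† = Q.centralizerAdjoint K c` (`Motives/HodgeStructureEndAlgCentralizerInvolutionMatrixPairs`); `S(H)(K) =
Q.lefschetzGroupBaseChange K`. "`Hom(Aᵢ, Aⱼ) = 0`" is `h0 : ∀ i ≠ j, ∀ φ : Hom (H j) (H i), φ.toLinearMap = 0`.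

## What is PROVED

* §1 DEF **`piBlockDiagEnd K W f = Σ_j (in_j)_K f_j (pr_j)_K`** (`⊕_j f_j`) with `proj_baseChange_piBlockDiagEnd_apply`,
  `piBlockDiagEnd_single_baseChange_apply`, `proj_baseChange_comp_piBlockDiagEnd_comp_single_baseChange` (blocks), `_mul`, `_one`,
  `_injective`, DEF `piBlockDiagEndAlgHom` (as `K`-algebra homomorphism), `coe_piBlockDiag_eq_piBlockDiagEnd` (dictionary with the
  group-level `piBlockDiag`), `piBlockDiagEnd_single`.
* §2 "`C(A) ⊂ C(A₁) × ⋯ × C(A_s)`" on `K`-points: `single_proj_baseChange_apply_comm_of_mem_centralizer_endAlg_pi_baseChange`,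
  `apply_single_baseChange_of_…`, **`eq_piBlockDiagEnd_of_mem_centralizer_endAlg_pi_baseChange`** (`c = ⊕_j c_j`,
  `c_j = (pr_j)_K c (in_j)_K`), **`block_mem_centralizer_endAlg_baseChange_of_mem_centralizer_endAlg_pi_baseChange`** (`c_j ∈ C(H_j)(K)`).
* §3 "with equality iff `Hom(Aᵢ, Aⱼ) = 0`": `baseChange_eq_piBlockDiagEnd_of_mem_endAlg_pi_of_hom_eq_zero` (`a_K` block diagonal
  for `a ∈ E_φ(⊕_j H_j)`), **`piBlockDiagEnd_mem_centralizer_endAlg_pi_baseChange_iff_of_hom_eq_zero`**,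
  `mem_centralizer_endAlg_pi_baseChange_iff_of_hom_eq_zero`, `piBlockDiagEnd_mulSingle_mem_…`.
* §4 DEF **`centralizerBaseChangePiAlgEquiv K H h0 : C(⊕_j H_j)(K) ≃ₐ[K] Π_j C(H_j)(K)`** (Proposition 1.1 on `K`-points),
  `coe_…_symm_apply` (inverse = `⊕`), `coe_…_apply` (= the blocks).
* §5 **`Polarization.adjointBaseChange_pi_piBlockDiagEnd`** (`(⊕_j f_j)† = ⊕_j f_j†`: "the restriction of the product of the
  involutions"), **`Polarization.centralizerBaseChangePiAlgEquiv_centralizerAdjoint`** ("of `k`-algebras with involution").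
* §6 `Polarization.adjoin_setOf_centralizerAdjoint_mul_self_eq_one_eq_top_iff` (for ANY polarized `H₀`: `(C(H₀)(K), †)` is
  generated by its unitary elements iff `K[S(H₀)(K)] = C(H₀)(K)`), `Polarization.adjointBaseChange_pi_piBlockDiagEnd_mulSingle_mul_self`,
  **`Polarization.adjoin_setOf_centralizerAdjoint_mul_self_eq_one_pi_eq_top`** (Lemma 3.5 passes to `Hom`-orthogonal sums —
  Milne's reduction, run inside `End_K(K ⊗ Π_j W_j)`: the unitary `⊕(1, …, −1ⱼ, …, 1)` yields the idempotents
  `(in_j)_K (pr_j)_K ∈ K[U]`), **`Polarization.adjoin_coe_lefschetzGroupBaseChange_pi_eq_centralizer`** (`K[S(H_j)(K)] = C(H_j)(K)`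
  for all `j` ⟹ `K[S(⊕_j H_j)(K)] = C(⊕_j H_j)(K)`).
* §7 powers: `single_comp_proj_mem_endAlg_pi_const`, `block_eq_block_of_mem_centralizer_endAlg_pi_const_baseChange`,
  `piBlockDiagEnd_const_mem_…`, **`mem_centralizer_endAlg_pi_const_baseChange_iff`** (`C(H₀^{⊕ι})(K) = Δ C(H₀)(K)`),
  `piBlockDiagEnd_const_injective`, DEF **`centralizerBaseChangePiConstAlgEquiv K H₀ : C(H₀)(K) ≃ₐ[K] C(H₀^{⊕ι})(K)`** (+ `coe_…_apply`),
  **`Polarization.centralizerBaseChangePiConstAlgEquiv_centralizerAdjoint`** ("as `k`-algebras with involution"),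
  **`Polarization.adjoin_setOf_centralizerAdjoint_mul_self_eq_one_pi_const_eq_top`**,
  **`Polarization.adjoin_coe_lefschetzGroupBaseChange_pi_const_eq_centralizer`** (`K[S(H₀)(K)] = C(H₀)(K)` ⟹ the same for `H₀^{⊕ι}`).

Engineering note (for the `Motives` layer): in `Module.End K (K ⊗[ℚ] V)` the lemmas `sub_self` / `add_neg_cancel` and the
instance `Ring ↥(Subalgebra …)` do not elaborate (the tensor product's `AddCommGroup`/`AddCommMonoid` instance paths), so §6
spells `−1` as `(-1 : K) • 1` and differences as `x + (-1 : K) • y`, and re-runs the argument of the tree's `adjoin_pi_eq_top`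
(`Literature/RingTheory/SimpleModule/InvolutionUnitaryGeneration`, which needs `Ring (R i)`) inside `End_K(K ⊗ Π_j W_j)`.

NOT here (honest scope): the `Hom`-orthogonality / power shape of a given `H` (the isogeny decomposition `A ~ ∏ Aᵢ^{rᵢ}` and the
simplicity of the factors are hypotheses `h0`, resp. the `pi`-carriers); "independent of the choice of the isogeny"; the transport
of `C(H)(K)`, `S(H)(K)` along an ISOMORPHISM of polarized Hodge structures (the tree's `Motives/HodgeStructureLefschetzGroupTransport`
treats `S`); the combination over a general `A` (sums of powers of pairwise non-isogenous simple factors of all four types) into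
one sentence. HC is NOT proved; nothing here claims a case of the Hodge conjecture.

## References

* [Milne1999LefschetzClasses] J. S. Milne, *Lefschetz classes on abelian varieties*, Duke Math. J. 96 (1999) 639–675 — §1 p. 643
  (L12–L31: powers, products, the product involution, Proposition 1.1), p. 644 L18 (`S(A)(R)`), Remark 1.6; §3 p. 653 (Lemma 3.5
  and the first sentence of its proof).
* [DeligneHodgeII1971] P. Deligne, *Théorie de Hodge II*, Publ. Math. IHÉS 40 (1971) — 2.1 (the category of Hodge structures is
  abelian; blocks of morphisms of direct sums), 2.1.15 (direct sums of polarizations).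
-/

noncomputable section

open TensorProduct

namespace Literature.AlgebraicGeometry.Motives

namespace HodgeStructure

universe u uK

variable (K : Type uK) [Field K] [Algebra ℚ K] {ι : Type} [Fintype ι] [DecidableEq ι]
  (W : ι → Type u) [∀ j, AddCommGroup (W j)] [∀ j, Module ℚ (W j)] {n : ℤ}
  {H : ∀ j, HodgeStructure (W j) n} (Q : ∀ j, Polarization (H j))

/-! ## §0 The base-changed block calculus on `K ⊗ (Π_j W_j)`: `(in_j)_K`, `(pr_j)_K` -/

section Plumbing

variable {W}

omit [Fintype ι] in
/-- `(pr_j)_K ((in_j)_K z) = z`. Private plumbing (the tree's copies are private). [folklore] -/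
private theorem proj_baseChange_single_baseChange_eq_self (j : ι) (z : K ⊗[ℚ] W j) :
    (LinearMap.proj j : (∀ k, W k) →ₗ[ℚ] W j).baseChange K ((LinearMap.single ℚ W j).baseChange K z) = z := by
  rw [← LinearMap.comp_apply, ← LinearMap.baseChange_comp, LinearMap.proj_comp_single_same, LinearMap.baseChange_id,
    LinearMap.id_apply]

omit [Fintype ι] in
/-- `(pr_i)_K ((in_j)_K z) = 0` for `i ≠ j`. Private plumbing. [folklore] -/
private theorem proj_baseChange_single_baseChange_eq_zero {i j : ι} (h : i ≠ j) (z : K ⊗[ℚ] W j) :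
    (LinearMap.proj i : (∀ k, W k) →ₗ[ℚ] W i).baseChange K ((LinearMap.single ℚ W j).baseChange K z) = 0 := by
  rw [← LinearMap.comp_apply, ← LinearMap.baseChange_comp, LinearMap.proj_comp_single_ne ℚ W i j h,
    LinearMap.baseChange_zero, LinearMap.zero_apply]

/-- `Σ_j (in_j)_K ((pr_j)_K x) = x`. Private plumbing. [folklore] -/
private theorem sum_single_baseChange_proj_baseChange_eq (x : K ⊗[ℚ] (∀ j, W j)) :
    ∑ j, (LinearMap.single ℚ W j).baseChange K ((LinearMap.proj j : (∀ k, W k) →ₗ[ℚ] W j).baseChange K x) = x := by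
  induction x using TensorProduct.induction_on with
  | zero => simp
  | tmul c v =>
    simp only [LinearMap.baseChange_tmul, LinearMap.coe_proj, Function.eval, LinearMap.coe_single]
    rw [← TensorProduct.tmul_sum, Finset.univ_sum_single]
  | add x y hx hy =>
    simp only [map_add, Finset.sum_add_distrib]
    rw [hx, hy]

/-- Two vectors of `K ⊗ (Π_j W_j)` with the same projections are equal. Private plumbing. [folklore] -/
private theorem eq_of_forall_proj_baseChange_eq {x y : K ⊗[ℚ] (∀ j, W j)}
    (h : ∀ j, (LinearMap.proj j : (∀ k, W k) →ₗ[ℚ] W j).baseChange K x =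
      (LinearMap.proj j : (∀ k, W k) →ₗ[ℚ] W j).baseChange K y) : x = y := by
  rw [← sum_single_baseChange_proj_baseChange_eq K x, ← sum_single_baseChange_proj_baseChange_eq K y]
  exact Finset.sum_congr rfl fun j _ ↦ by rw [h j]

omit [Fintype ι] in
/-- `(in_i a pr_j)_K = (in_i)_K ∘ a_K ∘ (pr_j)_K`. Private plumbing. [folklore] -/
private theorem baseChange_single_comp_comp_proj (i j : ι) (a : W j →ₗ[ℚ] W i) :
    (LinearMap.single ℚ W i ∘ₗ a ∘ₗ (LinearMap.proj j : (∀ k, W k) →ₗ[ℚ] W j)).baseChange K =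
      (LinearMap.single ℚ W i).baseChange K ∘ₗ a.baseChange K ∘ₗ
        (LinearMap.proj j : (∀ k, W k) →ₗ[ℚ] W j).baseChange K := by
  rw [LinearMap.baseChange_comp, LinearMap.baseChange_comp]

/-- **`a_K = Σ_{i,j} (in_i)_K (pr_i a in_j)_K (pr_j)_K`**: the base change of an endomorphism of `Π_j W_j` is the sum of
the base changes of its blocks. Private plumbing. [folklore] -/
private theorem baseChange_eq_sum_blocks (a : Module.End ℚ (∀ j, W j)) :
    a.baseChange K = ∑ i, ∑ j, (LinearMap.single ℚ W i).baseChange K ∘ₗ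
      (LinearMap.proj i ∘ₗ a ∘ₗ LinearMap.single ℚ W j).baseChange K ∘ₗ
        (LinearMap.proj j : (∀ k, W k) →ₗ[ℚ] W j).baseChange K := by
  refine LinearMap.ext fun x ↦ ?_
  conv_lhs => rw [← sum_single_baseChange_proj_baseChange_eq K x, map_sum,
    ← sum_single_baseChange_proj_baseChange_eq K (∑ j, _)]
  simp only [LinearMap.coe_sum, Finset.sum_apply, LinearMap.coe_comp, Function.comp_apply, map_sum,
    LinearMap.baseChange_comp]

end Plumbing

/-! ## §1 The block-diagonal algebra homomorphism `(f_j)_j ↦ ⊕_j f_j : Π_j End_K(K ⊗ W_j) → End_K(K ⊗ Π_j W_j)` -/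

section PiBlockDiag

/-- **The block-diagonal endomorphism `⊕_j f_j = Σ_j (in_j)_K f_j (pr_j)_K` of `K ⊗ (Π_j W_j)`** for a family of `K`-linear
endomorphisms `f_j` of the `K ⊗ W_j` (Milne's "`(c₁, …, c_s) ∈ C(A₁) × ⋯ × C(A_s)` acting on `V(A₁) ⊕ ⋯ ⊕ V(A_s)`", on
`K`-points; the underlying linear map of the tree's `piBlockDiag K W γ` for automorphisms, `coe_piBlockDiag`).
[cite: Milne1999LefschetzClasses, §1 p. 643 L14–L16 ("Let A = A₁ × ⋯ × A_s. Then C(A) ⊂ C(A₁) × ⋯ × C(A_s)")] -/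
def piBlockDiagEnd (f : ∀ j, Module.End K (K ⊗[ℚ] W j)) : Module.End K (K ⊗[ℚ] (∀ j, W j)) :=
  ∑ j, (LinearMap.single ℚ W j).baseChange K ∘ₗ f j ∘ₗ (LinearMap.proj j : (∀ k, W k) →ₗ[ℚ] W j).baseChange K

variable {W}

/-- **`(pr_j)_K ((⊕ f) x) = f_j ((pr_j)_K x)`.** [cite: Milne1999LefschetzClasses, §1 p. 643 L14–L16] -/
theorem proj_baseChange_piBlockDiagEnd_apply (f : ∀ j, Module.End K (K ⊗[ℚ] W j)) (j : ι) (x : K ⊗[ℚ] (∀ k, W k)) :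
    (LinearMap.proj j : (∀ k, W k) →ₗ[ℚ] W j).baseChange K (piBlockDiagEnd K W f x) =
      f j ((LinearMap.proj j : (∀ k, W k) →ₗ[ℚ] W j).baseChange K x) := by
  rw [piBlockDiagEnd, LinearMap.sum_apply, map_sum, Finset.sum_eq_single j]
  · rw [LinearMap.comp_apply, LinearMap.comp_apply, proj_baseChange_single_baseChange_eq_self]
  · intro i _ hij
    rw [LinearMap.comp_apply, LinearMap.comp_apply, proj_baseChange_single_baseChange_eq_zero K (Ne.symm hij)]
  · exact fun h ↦ (h (Finset.mem_univ j)).elim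

/-- **`(⊕ f) ((in_j)_K z) = (in_j)_K (f_j z)`.** [cite: Milne1999LefschetzClasses, §1 p. 643 L14–L16] -/
theorem piBlockDiagEnd_single_baseChange_apply (f : ∀ j, Module.End K (K ⊗[ℚ] W j)) (j : ι) (z : K ⊗[ℚ] W j) :
    piBlockDiagEnd K W f ((LinearMap.single ℚ W j).baseChange K z) = (LinearMap.single ℚ W j).baseChange K (f j z) := by
  rw [piBlockDiagEnd, LinearMap.sum_apply, Finset.sum_eq_single j]
  · rw [LinearMap.comp_apply, LinearMap.comp_apply, proj_baseChange_single_baseChange_eq_self]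
  · intro i _ hij
    rw [LinearMap.comp_apply, LinearMap.comp_apply, proj_baseChange_single_baseChange_eq_zero K hij, map_zero, map_zero]
  · exact fun h ↦ (h (Finset.mem_univ j)).elim

/-- **The `j`-th block of `⊕ f` is `f_j`: `(pr_j)_K ∘ (⊕ f) ∘ (in_j)_K = f_j`.** [cite: Milne1999LefschetzClasses, §1 p. 643 L14–L16] -/
theorem proj_baseChange_comp_piBlockDiagEnd_comp_single_baseChange (f : ∀ j, Module.End K (K ⊗[ℚ] W j)) (j : ι) :
    (LinearMap.proj j : (∀ k, W k) →ₗ[ℚ] W j).baseChange K ∘ₗ piBlockDiagEnd K W f ∘ₗ (LinearMap.single ℚ W j).baseChange K =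
      f j :=
  LinearMap.ext fun z ↦ by
    rw [LinearMap.comp_apply, LinearMap.comp_apply, piBlockDiagEnd_single_baseChange_apply,
      proj_baseChange_single_baseChange_eq_self]

/-- `⊕ (f g) = (⊕ f)(⊕ g)`. [cite: Milne1999LefschetzClasses, §1 p. 643 L14–L16] -/
theorem piBlockDiagEnd_mul (f g : ∀ j, Module.End K (K ⊗[ℚ] W j)) :
    piBlockDiagEnd K W (f * g) = piBlockDiagEnd K W f * piBlockDiagEnd K W g :=
  LinearMap.ext fun x ↦ eq_of_forall_proj_baseChange_eq K fun j ↦ by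
    rw [proj_baseChange_piBlockDiagEnd_apply, Module.End.mul_apply, proj_baseChange_piBlockDiagEnd_apply,
      proj_baseChange_piBlockDiagEnd_apply, Pi.mul_apply, Module.End.mul_apply]

/-- `⊕ 1 = 1`. [cite: Milne1999LefschetzClasses, §1 p. 643 L14–L16] -/
theorem piBlockDiagEnd_one : piBlockDiagEnd K W (1 : ∀ j, Module.End K (K ⊗[ℚ] W j)) = 1 :=
  LinearMap.ext fun x ↦ eq_of_forall_proj_baseChange_eq K fun j ↦ by
    rw [proj_baseChange_piBlockDiagEnd_apply, Pi.one_apply, Module.End.one_apply, Module.End.one_apply]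

/-- `⊕` is injective (its `j`-th block is `f_j`). [cite: Milne1999LefschetzClasses, §1 p. 643 L14–L16] -/
theorem piBlockDiagEnd_injective : Function.Injective (piBlockDiagEnd K W) := fun f g h ↦
  funext fun j ↦ by
    rw [← proj_baseChange_comp_piBlockDiagEnd_comp_single_baseChange K f j, h,
      proj_baseChange_comp_piBlockDiagEnd_comp_single_baseChange]

variable (W) in
/-- **`⊕` as a `K`-algebra homomorphism `Π_j End_K(K ⊗ W_j) →ₐ[K] End_K(K ⊗ Π_j W_j)`** (the diagonal inclusion
"`C(A₁) × ⋯ × C(A_s)` acting on `V(A)`"). [cite: Milne1999LefschetzClasses, §1 p. 643 L14–L16 and Proposition 1.1] -/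
def piBlockDiagEndAlgHom : (∀ j, Module.End K (K ⊗[ℚ] W j)) →ₐ[K] Module.End K (K ⊗[ℚ] (∀ j, W j)) where
  toFun := piBlockDiagEnd K W
  map_one' := piBlockDiagEnd_one K
  map_mul' := piBlockDiagEnd_mul K
  map_zero' := by simp [piBlockDiagEnd]
  map_add' f g := by
    simp only [piBlockDiagEnd, Pi.add_apply, LinearMap.comp_add, LinearMap.add_comp, Finset.sum_add_distrib]
  commutes' k := LinearMap.ext fun x ↦ eq_of_forall_proj_baseChange_eq K fun j ↦ by
    rw [proj_baseChange_piBlockDiagEnd_apply, Pi.algebraMap_apply, Module.algebraMap_end_apply,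
      Module.algebraMap_end_apply, map_smul]

/-- Unfolding. [cite: Milne1999LefschetzClasses, §1 p. 643 L14–L16] -/
@[simp] theorem piBlockDiagEndAlgHom_apply (f : ∀ j, Module.End K (K ⊗[ℚ] W j)) :
    piBlockDiagEndAlgHom K W f = piBlockDiagEnd K W f :=
  rfl

/-- Dictionary with the group-level embedding: the underlying linear map of the tree's `piBlockDiag K W γ` is `⊕_j γ_j`.
[cite: Milne1999LefschetzClasses, §1 Proposition 1.5 (p. 644)] -/
theorem coe_piBlockDiag_eq_piBlockDiagEnd (γ : ∀ j, (K ⊗[ℚ] W j) ≃ₗ[K] (K ⊗[ℚ] W j)) :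
    (piBlockDiag K W γ : Module.End K (K ⊗[ℚ] (∀ j, W j))) =
      piBlockDiagEnd K W fun j ↦ (γ j : Module.End K (K ⊗[ℚ] W j)) :=
  coe_piBlockDiag γ

end PiBlockDiag

/-! ## §2 "`C(A) ⊂ C(A₁) × ⋯ × C(A_s)`" on `K`-points: every `c ∈ C(⊕_j H_j)(K)` is block diagonal with blocks in the `C(H_j)(K)` -/

section Blocks

variable {W Q}

/-- An element of `C(⊕_j H_j)(K)` commutes with the base-changed Hodge idempotent `(in_j pr_j)_K` (pointwise).
[cite: Milne1999LefschetzClasses, §1 p. 643 L14–L16 ("C(A) ⊂ C(A₁) × ⋯ × C(A_s)") and Remark 1.6] -/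
theorem single_proj_baseChange_apply_comm_of_mem_centralizer_endAlg_pi_baseChange {c : Module.End K (K ⊗[ℚ] (∀ j, W j))}
    (hc : c ∈ Subalgebra.centralizer K ((fun a : Module.End ℚ (∀ j, W j) ↦ a.baseChange K) ''
      ((HodgeStructure.pi H).endAlg : Set (Module.End ℚ (∀ j, W j)))))
    (j : ι) (x : K ⊗[ℚ] (∀ j, W j)) :
    (LinearMap.single ℚ W j).baseChange K ((LinearMap.proj j : (∀ k, W k) →ₗ[ℚ] W j).baseChange K (c x)) =
      c ((LinearMap.single ℚ W j).baseChange K ((LinearMap.proj j : (∀ k, W k) →ₗ[ℚ] W j).baseChange K x)) := by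
  have h := LinearMap.congr_fun (baseChange_mul_eq_of_mem_centralizer K hc (single_comp_proj_mem_endAlg_pi H j)) x
  simpa only [Module.End.mul_apply, LinearMap.baseChange_comp, LinearMap.coe_comp, Function.comp_apply] using h

/-- **`c ∈ C(⊕_j H_j)(K)` preserves each summand**: `c ((in_j)_K z) = (in_j)_K ((pr_j)_K (c ((in_j)_K z)))`.
[cite: Milne1999LefschetzClasses, §1 p. 643 L14–L16 and Remark 1.6] -/
theorem apply_single_baseChange_of_mem_centralizer_endAlg_pi_baseChange {c : Module.End K (K ⊗[ℚ] (∀ j, W j))}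
    (hc : c ∈ Subalgebra.centralizer K ((fun a : Module.End ℚ (∀ j, W j) ↦ a.baseChange K) ''
      ((HodgeStructure.pi H).endAlg : Set (Module.End ℚ (∀ j, W j)))))
    (j : ι) (z : K ⊗[ℚ] W j) :
    c ((LinearMap.single ℚ W j).baseChange K z) = (LinearMap.single ℚ W j).baseChange K
      ((LinearMap.proj j : (∀ k, W k) →ₗ[ℚ] W j).baseChange K (c ((LinearMap.single ℚ W j).baseChange K z))) := by
  conv_lhs => rw [← proj_baseChange_single_baseChange_eq_self K j z]
  rw [← single_proj_baseChange_apply_comm_of_mem_centralizer_endAlg_pi_baseChange K hc j]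

/-- **`c ∈ C(⊕_j H_j)(K)` is block diagonal: `c = ⊕_j ((pr_j)_K c (in_j)_K)`.** [cite: Milne1999LefschetzClasses, §1 p. 643 L14–L16 ("C(A) ⊂ C(A₁) × ⋯ × C(A_s)") and Remark 1.6] -/
theorem eq_piBlockDiagEnd_of_mem_centralizer_endAlg_pi_baseChange {c : Module.End K (K ⊗[ℚ] (∀ j, W j))}
    (hc : c ∈ Subalgebra.centralizer K ((fun a : Module.End ℚ (∀ j, W j) ↦ a.baseChange K) ''
      ((HodgeStructure.pi H).endAlg : Set (Module.End ℚ (∀ j, W j))))) :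
    c = piBlockDiagEnd K W fun j ↦ (LinearMap.proj j : (∀ k, W k) →ₗ[ℚ] W j).baseChange K ∘ₗ c ∘ₗ
      (LinearMap.single ℚ W j).baseChange K := by
  refine LinearMap.ext fun x ↦ eq_of_forall_proj_baseChange_eq K fun j ↦ ?_
  rw [proj_baseChange_piBlockDiagEnd_apply, LinearMap.comp_apply, LinearMap.comp_apply,
    ← single_proj_baseChange_apply_comm_of_mem_centralizer_endAlg_pi_baseChange K hc j,
    proj_baseChange_single_baseChange_eq_self]

/-- **The `j`-th block of `c ∈ C(⊕_k H_k)(K)` lies in `C(H_j)(K)`** ("`C(A) ⊂ C(A₁) × ⋯ × C(A_s)`" on `K`-points: `c` commutes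
with `(in_j a pr_j)_K` for `a ∈ End_HS(H_j)`). [cite: Milne1999LefschetzClasses, §1 p. 643 L14–L16 and Remark 1.6] -/
theorem block_mem_centralizer_endAlg_baseChange_of_mem_centralizer_endAlg_pi_baseChange
    {c : Module.End K (K ⊗[ℚ] (∀ j, W j))}
    (hc : c ∈ Subalgebra.centralizer K ((fun a : Module.End ℚ (∀ j, W j) ↦ a.baseChange K) ''
      ((HodgeStructure.pi H).endAlg : Set (Module.End ℚ (∀ j, W j))))) (j : ι) :
    (LinearMap.proj j : (∀ k, W k) →ₗ[ℚ] W j).baseChange K ∘ₗ c ∘ₗ (LinearMap.single ℚ W j).baseChange K ∈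
      Subalgebra.centralizer K ((fun a : Module.End ℚ (W j) ↦ a.baseChange K) '' ((H j).endAlg : Set (Module.End ℚ (W j)))) := by
  rw [Subalgebra.mem_centralizer_iff]
  rintro _ ⟨a, ha, rfl⟩
  dsimp only
  have h := baseChange_mul_eq_of_mem_centralizer K hc (single_comp_comp_proj_mem_endAlg_pi H ha)
  rw [baseChange_single_comp_comp_proj] at h
  refine LinearMap.ext fun z ↦ ?_
  have hz := LinearMap.congr_fun h ((LinearMap.single ℚ W j).baseChange K z)
  simp only [Module.End.mul_apply, LinearMap.comp_apply, proj_baseChange_single_baseChange_eq_self] at hz ⊢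
  -- `hz : (in_j)_K (a_K ((pr_j)_K (c ((in_j)_K z)))) = c ((in_j)_K (a_K z))`
  rw [← hz, proj_baseChange_single_baseChange_eq_self]

end Blocks

/-! ## §3 "with equality holding if and only if `Hom(Aᵢ, Aⱼ) = 0`": for a pairwise `Hom`-orthogonal family,
`⊕_j f_j ∈ C(⊕_j H_j)(K)` iff every `f_j ∈ C(H_j)(K)` -/

section Orthogonal

variable {W Q}

/-- **For a pairwise `Hom`-orthogonal family the base change of a Hodge endomorphism of `⊕_j H_j` is block diagonal**:
`a_K = ⊕_j (pr_j a in_j)_K` (the off-diagonal blocks are morphisms `H_j → H_i`, hence `0`).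
[cite: Milne1999LefschetzClasses, §1 p. 643 L14–L16 ("with equality holding if and only if Hom(Aᵢ, Aⱼ) = 0 for all i ≠ j")] [cite: DeligneHodgeII1971, 2.1] -/
theorem baseChange_eq_piBlockDiagEnd_of_mem_endAlg_pi_of_hom_eq_zero
    (h0 : ∀ i j, i ≠ j → ∀ φ : Hom (H j) (H i), φ.toLinearMap = 0) {a : Module.End ℚ (∀ j, W j)}
    (ha : a ∈ (HodgeStructure.pi H).endAlg) :
    a.baseChange K = piBlockDiagEnd K W fun j ↦ (LinearMap.proj j ∘ₗ a ∘ₗ LinearMap.single ℚ W j).baseChange K := by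
  rw [baseChange_eq_sum_blocks K a, piBlockDiagEnd]
  refine Finset.sum_congr rfl fun i _ ↦ ?_
  rw [Finset.sum_eq_single i]
  · intro j _ hji
    obtain ⟨φ, hφ⟩ := exists_hom_toLinearMap_eq_block H ha i j
    rw [← hφ, h0 i j (Ne.symm hji) φ, LinearMap.baseChange_zero, LinearMap.zero_comp, LinearMap.comp_zero]
  · exact fun h ↦ (h (Finset.mem_univ i)).elim

/-- **`⊕_j f_j ∈ C(⊕_j H_j)(K)` iff every `f_j ∈ C(H_j)(K)`**, for a pairwise `Hom`-orthogonal family ("with equality holding if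
and only if `Hom(Aᵢ, Aⱼ) = 0`", on `K`-points). [cite: Milne1999LefschetzClasses, §1 p. 643 L14–L16 and Proposition 1.1] -/
theorem piBlockDiagEnd_mem_centralizer_endAlg_pi_baseChange_iff_of_hom_eq_zero
    (h0 : ∀ i j, i ≠ j → ∀ φ : Hom (H j) (H i), φ.toLinearMap = 0) (f : ∀ j, Module.End K (K ⊗[ℚ] W j)) :
    piBlockDiagEnd K W f ∈ Subalgebra.centralizer K ((fun a : Module.End ℚ (∀ j, W j) ↦ a.baseChange K) ''
        ((HodgeStructure.pi H).endAlg : Set (Module.End ℚ (∀ j, W j)))) ↔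
      ∀ j, f j ∈ Subalgebra.centralizer K ((fun a : Module.End ℚ (W j) ↦ a.baseChange K) ''
        ((H j).endAlg : Set (Module.End ℚ (W j)))) := by
  constructor
  · intro hc j
    have h := block_mem_centralizer_endAlg_baseChange_of_mem_centralizer_endAlg_pi_baseChange K hc j
    rwa [proj_baseChange_comp_piBlockDiagEnd_comp_single_baseChange] at h
  · intro hf
    rw [Subalgebra.mem_centralizer_iff]
    rintro _ ⟨a, ha, rfl⟩
    dsimp only
    rw [baseChange_eq_piBlockDiagEnd_of_mem_endAlg_pi_of_hom_eq_zero K h0 ha, ← piBlockDiagEnd_mul, ← piBlockDiagEnd_mul]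
    congr 1
    funext j
    rw [Pi.mul_apply, Pi.mul_apply]
    obtain ⟨φ, hφ⟩ := exists_hom_toLinearMap_eq_block H ha j j
    rw [← hφ]
    exact baseChange_mul_eq_of_mem_centralizer K (hf j) (Hom.toLinearMap_mem_endAlg φ)

/-- **Proposition 1.1 on `K`-points, membership form**: for a pairwise `Hom`-orthogonal family, `c ∈ C(⊕_j H_j)(K)` iff
`c = ⊕_j f_j` with every `f_j ∈ C(H_j)(K)`. [cite: Milne1999LefschetzClasses, §1 Proposition 1.1 (p. 643) and Remark 1.6] -/
theorem mem_centralizer_endAlg_pi_baseChange_iff_of_hom_eq_zero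
    (h0 : ∀ i j, i ≠ j → ∀ φ : Hom (H j) (H i), φ.toLinearMap = 0) (c : Module.End K (K ⊗[ℚ] (∀ j, W j))) :
    c ∈ Subalgebra.centralizer K ((fun a : Module.End ℚ (∀ j, W j) ↦ a.baseChange K) ''
        ((HodgeStructure.pi H).endAlg : Set (Module.End ℚ (∀ j, W j)))) ↔
      ∃ f : ∀ j, Module.End K (K ⊗[ℚ] W j),
        (∀ j, f j ∈ Subalgebra.centralizer K ((fun a : Module.End ℚ (W j) ↦ a.baseChange K) ''
          ((H j).endAlg : Set (Module.End ℚ (W j))))) ∧ c = piBlockDiagEnd K W f := by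
  constructor
  · intro hc
    exact ⟨_, block_mem_centralizer_endAlg_baseChange_of_mem_centralizer_endAlg_pi_baseChange K hc,
      eq_piBlockDiagEnd_of_mem_centralizer_endAlg_pi_baseChange K hc⟩
  · rintro ⟨f, hf, rfl⟩
    exact (piBlockDiagEnd_mem_centralizer_endAlg_pi_baseChange_iff_of_hom_eq_zero K h0 f).2 hf

/-! ## §4 `C(⊕_j H_j)(K) ≃ₐ[K] Π_j C(H_j)(K)` for a pairwise `Hom`-orthogonal family (Proposition 1.1 on `K`-points) -/

variable (H) in
/-- **Milne's Proposition 1.1 on `K`-points: `C(⊕_j H_j)(K) ≃ₐ[K] Π_j C(H_j)(K)`, `c ↦ ((pr_j)_K c (in_j)_K)_j`,** for a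
pairwise `Hom`-orthogonal finite family of `ℚ`-Hodge structures and every field `K ⊇ ℚ` (inverse: `(f_j) ↦ ⊕_j f_j`) —
"an isomorphism `C(A₁) × ⋯ × C(A_s) → C(A)` of `k`-algebras", read through the functor of points (Remark 1.6); the
`K`-points companion of the seat's `centralizerPiAlgEquiv` (`k = ℚ`). [cite: Milne1999LefschetzClasses, §1 Proposition 1.1 (p. 643 L28–L31) and Remark 1.6 (p. 644)] -/
def centralizerBaseChangePiAlgEquiv (h0 : ∀ i j, i ≠ j → ∀ φ : Hom (H j) (H i), φ.toLinearMap = 0) :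
    Subalgebra.centralizer K ((fun a : Module.End ℚ (∀ j, W j) ↦ a.baseChange K) ''
        ((HodgeStructure.pi H).endAlg : Set (Module.End ℚ (∀ j, W j)))) ≃ₐ[K]
      ∀ j, Subalgebra.centralizer K ((fun a : Module.End ℚ (W j) ↦ a.baseChange K) ''
        ((H j).endAlg : Set (Module.End ℚ (W j)))) :=
  AlgEquiv.symm <| AlgEquiv.ofBijective
    { toFun := fun f ↦ ⟨piBlockDiagEnd K W fun j ↦ (f j : Module.End K (K ⊗[ℚ] W j)),
        (piBlockDiagEnd_mem_centralizer_endAlg_pi_baseChange_iff_of_hom_eq_zero K h0 _).2 fun j ↦ (f j).2⟩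
      map_one' := Subtype.ext (piBlockDiagEnd_one K)
      map_mul' := fun f g ↦ Subtype.ext (piBlockDiagEnd_mul K _ _)
      map_zero' := Subtype.ext (by simp [piBlockDiagEnd])
      map_add' := fun f g ↦ Subtype.ext (map_add (piBlockDiagEndAlgHom K W) _ _)
      commutes' := fun k ↦ Subtype.ext ((piBlockDiagEndAlgHom K W).commutes k) }
    ⟨fun f g h ↦ funext fun j ↦ Subtype.ext (congr_fun (piBlockDiagEnd_injective K (congr_arg Subtype.val h)) j),
      fun c ↦ ⟨fun j ↦ ⟨_, block_mem_centralizer_endAlg_baseChange_of_mem_centralizer_endAlg_pi_baseChange K c.2 j⟩,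
        Subtype.ext (eq_piBlockDiagEnd_of_mem_centralizer_endAlg_pi_baseChange K c.2).symm⟩⟩

/-- The inverse IS the block-diagonal map: `(equiv.symm f : End) = ⊕_j f_j`. [cite: Milne1999LefschetzClasses, §1 Proposition 1.1 (p. 643)] -/
@[simp] theorem coe_centralizerBaseChangePiAlgEquiv_symm_apply
    (h0 : ∀ i j, i ≠ j → ∀ φ : Hom (H j) (H i), φ.toLinearMap = 0)
    (f : ∀ j, Subalgebra.centralizer K ((fun a : Module.End ℚ (W j) ↦ a.baseChange K) ''
      ((H j).endAlg : Set (Module.End ℚ (W j))))) :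
    ((centralizerBaseChangePiAlgEquiv K H h0).symm f : Module.End K (K ⊗[ℚ] (∀ j, W j))) =
      piBlockDiagEnd K W fun j ↦ (f j : Module.End K (K ⊗[ℚ] W j)) :=
  rfl

/-- The equivalence IS "take the blocks": `(equiv c j : End) = (pr_j)_K c (in_j)_K`. [cite: Milne1999LefschetzClasses, §1 Proposition 1.1 (p. 643)] -/
@[simp] theorem coe_centralizerBaseChangePiAlgEquiv_apply
    (h0 : ∀ i j, i ≠ j → ∀ φ : Hom (H j) (H i), φ.toLinearMap = 0)
    (c : Subalgebra.centralizer K ((fun a : Module.End ℚ (∀ j, W j) ↦ a.baseChange K) ''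
      ((HodgeStructure.pi H).endAlg : Set (Module.End ℚ (∀ j, W j))))) (j : ι) :
    ((centralizerBaseChangePiAlgEquiv K H h0 c j : Subalgebra.centralizer K ((fun a : Module.End ℚ (W j) ↦ a.baseChange K) ''
        ((H j).endAlg : Set (Module.End ℚ (W j))))) : Module.End K (K ⊗[ℚ] W j)) =
      (LinearMap.proj j : (∀ k, W k) →ₗ[ℚ] W j).baseChange K ∘ₗ (c : Module.End K (K ⊗[ℚ] (∀ j, W j))) ∘ₗ
        (LinearMap.single ℚ W j).baseChange K := by
  have h : (centralizerBaseChangePiAlgEquiv K H h0).symm (centralizerBaseChangePiAlgEquiv K H h0 c) = c :=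
    (centralizerBaseChangePiAlgEquiv K H h0).symm_apply_apply c
  have h' := congr_arg (fun d : Subalgebra.centralizer K ((fun a : Module.End ℚ (∀ j, W j) ↦ a.baseChange K) ''
      ((HodgeStructure.pi H).endAlg : Set (Module.End ℚ (∀ j, W j)))) ↦
    (LinearMap.proj j : (∀ k, W k) →ₗ[ℚ] W j).baseChange K ∘ₗ (d : Module.End K (K ⊗[ℚ] (∀ j, W j))) ∘ₗ
      (LinearMap.single ℚ W j).baseChange K) h
  simp only [coe_centralizerBaseChangePiAlgEquiv_symm_apply, proj_baseChange_comp_piBlockDiagEnd_comp_single_baseChange] at h'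
  exact h'

end Orthogonal

/-! ## §5 "as `k`-algebras with involution": the involution of `⊕_j Q_j` is the product of the involutions -/

section Involution

variable {W Q} [∀ j, Module.Finite ℚ (W j)]

/-- **The adjoint of a block-diagonal operator for `(⊕_j Q_j)_K` is the block-diagonal operator of the adjoints**:
`(⊕_j f_j)† = ⊕_j f_j†` ("the involution it defines on `C(A)` is the restriction of the product of the involutions on the
`C(Aᵢ)` defined by the `Dᵢ`", on `K`-points; `(⊕Q)_K = Σ_j (Q_j)_K ∘ ((pr_j)_K × (pr_j)_K)`). [cite: Milne1999LefschetzClasses, §1 p. 643 L21–L27 ("the involution it defines on C(A) is the restriction of the product of the involutions on the C(Aᵢ)")] -/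
theorem Polarization.adjointBaseChange_pi_piBlockDiagEnd (f : ∀ j, Module.End K (K ⊗[ℚ] W j)) :
    (Polarization.pi Q).adjointBaseChange K (piBlockDiagEnd K W f) =
      piBlockDiagEnd K W fun j ↦ (Q j).adjointBaseChange K (f j) := by
  symm
  refine (Polarization.pi Q).eq_adjointBaseChange_of_isAdjointPair K ?_
  intro x y
  rw [Polarization.baseChange_pi_form_apply, Polarization.baseChange_pi_form_apply]
  refine Finset.sum_congr rfl fun j _ ↦ ?_
  rw [proj_baseChange_piBlockDiagEnd_apply, proj_baseChange_piBlockDiagEnd_apply,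
    (Q j).baseChange_form_apply_adjointBaseChange K]

/-- **`C(⊕_j H_j)(K) ≃ₐ[K] Π_j C(H_j)(K)` is an isomorphism of algebras WITH INVOLUTION**: the `j`-th block of `c†` is
`(c_j)†` (`†` = `Polarization.centralizerAdjoint` for `⊕_j Q_j`, resp. `Q_j`). [cite: Milne1999LefschetzClasses, §1 Proposition 1.1 (p. 643 L28–L31, "an isomorphism C(A₁) × ⋯ × C(A_s) → C(A) of k-algebras with involution") and L21–L27] -/
theorem Polarization.centralizerBaseChangePiAlgEquiv_centralizerAdjoint
    (h0 : ∀ i j, i ≠ j → ∀ φ : Hom (H j) (H i), φ.toLinearMap = 0)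
    (c : Subalgebra.centralizer K ((fun a : Module.End ℚ (∀ j, W j) ↦ a.baseChange K) ''
      ((HodgeStructure.pi H).endAlg : Set (Module.End ℚ (∀ j, W j))))) (j : ι) :
    centralizerBaseChangePiAlgEquiv K H h0 ((Polarization.pi Q).centralizerAdjoint K c) j =
      (Q j).centralizerAdjoint K (centralizerBaseChangePiAlgEquiv K H h0 c j) := by
  set Ψ := centralizerBaseChangePiAlgEquiv K H h0 with hΨ
  have hc : (c : Module.End K (K ⊗[ℚ] (∀ j, W j))) =
      piBlockDiagEnd K W fun j ↦ ((Ψ c j : Subalgebra.centralizer K ((fun a : Module.End ℚ (W j) ↦ a.baseChange K) ''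
        ((H j).endAlg : Set (Module.End ℚ (W j))))) : Module.End K (K ⊗[ℚ] W j)) := by
    rw [← coe_centralizerBaseChangePiAlgEquiv_symm_apply K h0, AlgEquiv.symm_apply_apply]
  have key : (Polarization.pi Q).centralizerAdjoint K c = Ψ.symm fun j ↦ (Q j).centralizerAdjoint K (Ψ c j) := by
    refine Subtype.ext ?_
    rw [Polarization.coe_centralizerAdjoint, coe_centralizerBaseChangePiAlgEquiv_symm_apply, hc,
      Polarization.adjointBaseChange_pi_piBlockDiagEnd]
    rfl
  rw [key, AlgEquiv.apply_symm_apply]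

end Involution

/-! ## §6 "The `k`-algebra `C(A)` is generated by the `γ ∈ S(A)(k)`" passes to `Hom`-orthogonal direct sums -/

section Generation

variable {V : Type u} [AddCommGroup V] [Module ℚ V] [Module.Finite ℚ V] {H₀ : HodgeStructure V n} (Q₀ : Polarization H₀)

omit [Fintype ι] [DecidableEq ι] in
/-- **`(C(H)(K), †)` is generated by its unitary elements iff `K[S(H)(K)] = C(H)(K)`** — the two readings of "the
`k`-algebra `C(A)` is generated by the `γ ∈ S(A)(k)`" (`S(A)(K)` = the unitary elements of `C(A) ⊗ K`, the seat's
`Polarization.image_coe_lefschetzGroupBaseChange_eq`). [cite: Milne1999LefschetzClasses, §3 p. 653 L42–L46 and §1 p. 644 L18 ("S(A)(R) = {γ ∈ C(A) ⊗_k R | γ†γ = 1}")] -/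
theorem Polarization.adjoin_setOf_centralizerAdjoint_mul_self_eq_one_eq_top_iff :
    Algebra.adjoin K {c : Subalgebra.centralizer K ((fun a : Module.End ℚ V ↦ a.baseChange K) ''
        (H₀.endAlg : Set (Module.End ℚ V))) | Q₀.centralizerAdjoint K c * c = 1} = ⊤ ↔
      Algebra.adjoin K ((fun γ : (K ⊗[ℚ] V) ≃ₗ[K] (K ⊗[ℚ] V) ↦ (γ : Module.End K (K ⊗[ℚ] V))) ''
          (Q₀.lefschetzGroupBaseChange K : Set _)) =
        Subalgebra.centralizer K ((fun a : Module.End ℚ V ↦ a.baseChange K) '' (H₀.endAlg : Set (Module.End ℚ V))) := by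
  set C := Subalgebra.centralizer K ((fun a : Module.End ℚ V ↦ a.baseChange K) '' (H₀.endAlg : Set (Module.End ℚ V)))
  have hval : (Algebra.adjoin K {c : C | Q₀.centralizerAdjoint K c * c = 1}).map C.val =
      Algebra.adjoin K ((fun γ : (K ⊗[ℚ] V) ≃ₗ[K] (K ⊗[ℚ] V) ↦ (γ : Module.End K (K ⊗[ℚ] V))) ''
        (Q₀.lefschetzGroupBaseChange K : Set _)) := by
    rw [AlgHom.map_adjoin, Q₀.image_coe_lefschetzGroupBaseChange_eq K]
    rfl
  constructor
  · intro htop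
    rw [← hval, htop, Algebra.map_top, Subalgebra.range_val]
  · intro hS
    apply Subalgebra.map_injective (f := C.val) Subtype.val_injective
    rw [hval, hS, Algebra.map_top, Subalgebra.range_val]

variable {W Q}

/-- **`⊕_i (δ_{ij} x) = (in_j)_K x (pr_j)_K`**: the block-diagonal operator of a family supported at `j` is the `(j, j)`-block
operator. [cite: Milne1999LefschetzClasses, §1 p. 643 L14–L16] -/
theorem piBlockDiagEnd_single (j : ι) (x : Module.End K (K ⊗[ℚ] W j)) :
    piBlockDiagEnd K W (Pi.single j x) =
      (LinearMap.single ℚ W j).baseChange K ∘ₗ x ∘ₗ (LinearMap.proj j : (∀ k, W k) →ₗ[ℚ] W j).baseChange K := by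
  rw [piBlockDiagEnd, Finset.sum_eq_single j]
  · rw [Pi.single_eq_same]
  · intro i _ hij
    rw [Pi.single_eq_of_ne hij, LinearMap.zero_comp, LinearMap.comp_zero]
  · exact fun h ↦ (h (Finset.mem_univ j)).elim

/-- `⊕_i (mulSingle j x)_i ∈ C(⊕_j H_j)(K)` for `x ∈ C(H_j)(K)` (blocks `x` at `j`, `1` elsewhere), `Hom`-orthogonal family.
[cite: Milne1999LefschetzClasses, §1 Proposition 1.1 (p. 643)] -/
theorem piBlockDiagEnd_mulSingle_mem_centralizer_endAlg_pi_baseChange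
    (h0 : ∀ i j, i ≠ j → ∀ φ : Hom (H j) (H i), φ.toLinearMap = 0) {j : ι} {x : Module.End K (K ⊗[ℚ] W j)}
    (hx : x ∈ Subalgebra.centralizer K ((fun a : Module.End ℚ (W j) ↦ a.baseChange K) ''
      ((H j).endAlg : Set (Module.End ℚ (W j))))) :
    piBlockDiagEnd K W (Pi.mulSingle j x) ∈ Subalgebra.centralizer K ((fun a : Module.End ℚ (∀ j, W j) ↦ a.baseChange K) ''
      ((HodgeStructure.pi H).endAlg : Set (Module.End ℚ (∀ j, W j)))) :=
  (piBlockDiagEnd_mem_centralizer_endAlg_pi_baseChange_iff_of_hom_eq_zero K h0 _).2 fun i ↦ by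
    rcases eq_or_ne i j with rfl | hij
    · rwa [Pi.mulSingle_eq_same]
    · rw [Pi.mulSingle_eq_of_ne hij]
      exact Subalgebra.one_mem _

variable [∀ j, Module.Finite ℚ (W j)]

/-- **`⊕_i (mulSingle j u)_i` is unitary for `(⊕_j Q_j)_K` when `u†u = 1`.** [cite: Milne1999LefschetzClasses, §1 p. 643 L21–L27 (product involution) and §3 proof of Lemma 3.5 (p. 653 L47 – p. 654 L6)] -/
theorem Polarization.adjointBaseChange_pi_piBlockDiagEnd_mulSingle_mul_self {j : ι} {u : Module.End K (K ⊗[ℚ] W j)}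
    (hu : (Q j).adjointBaseChange K u * u = 1) :
    (Polarization.pi Q).adjointBaseChange K (piBlockDiagEnd K W (Pi.mulSingle j u)) *
      piBlockDiagEnd K W (Pi.mulSingle j u) = 1 := by
  rw [Polarization.adjointBaseChange_pi_piBlockDiagEnd, ← piBlockDiagEnd_mul, ← piBlockDiagEnd_one K]
  congr 1
  funext i
  rw [Pi.mul_apply, Pi.one_apply]
  rcases eq_or_ne i j with rfl | hij
  · rw [Pi.mulSingle_eq_same, hu]
  · rw [Pi.mulSingle_eq_of_ne hij, (Q i).adjointBaseChange_one K, mul_one]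

/-- **Milne's Lemma 3.5 passes to products**: if every `(C(H_j)(K), †)` is generated by its unitary elements, so is
`(C(⊕_j H_j)(K), †)` for a pairwise `Hom`-orthogonal family — "Each pair `(R, †)` is a product of pairs […] We may assume
`(R, †)` is one of the above pairs": inside `End_K(K ⊗ Π_j W_j)`, the unitary `⊕(1, …, -1_j, …, 1)` puts the idempotent
`(in_j)_K (pr_j)_K = ½(1 − ⊕(1, …, -1_j, …, 1))` into `K[U]`, then `(in_j)_K u (pr_j)_K = ⊕(1, …, u, …, 1) ∘ (in_j)_K (pr_j)_K ∈ K[U]`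
for unitary `u`, the `x ∈ C(H_j)(K)` with `(in_j)_K x (pr_j)_K ∈ K[U]` form a subalgebra containing the unitaries, and every
`c ∈ C(⊕_j H_j)(K)` is `Σ_j (in_j)_K c_j (pr_j)_K` (§2) (`2 ≠ 0` in the `ℚ`-algebra `K`; the argument of the tree's
`adjoin_pi_eq_top` of `Literature/RingTheory/SimpleModule/InvolutionUnitaryGeneration`, run inside `End_K(K ⊗ Π_j W_j)`).
[cite: Milne1999LefschetzClasses, §3 proof of Lemma 3.5 (p. 653 L47 – p. 654 L6) and §1 Proposition 1.1 (p. 643)] -/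
theorem Polarization.adjoin_setOf_centralizerAdjoint_mul_self_eq_one_pi_eq_top
    (h0 : ∀ i j, i ≠ j → ∀ φ : Hom (H j) (H i), φ.toLinearMap = 0)
    (hU : ∀ j, Algebra.adjoin K {c : Subalgebra.centralizer K ((fun a : Module.End ℚ (W j) ↦ a.baseChange K) ''
      ((H j).endAlg : Set (Module.End ℚ (W j)))) | (Q j).centralizerAdjoint K c * c = 1} = ⊤) :
    Algebra.adjoin K {c : Subalgebra.centralizer K ((fun a : Module.End ℚ (∀ j, W j) ↦ a.baseChange K) ''
      ((HodgeStructure.pi H).endAlg : Set (Module.End ℚ (∀ j, W j)))) |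
        (Polarization.pi Q).centralizerAdjoint K c * c = 1} = ⊤ := by
  set C := Subalgebra.centralizer K ((fun a : Module.End ℚ (∀ j, W j) ↦ a.baseChange K) ''
      ((HodgeStructure.pi H).endAlg : Set (Module.End ℚ (∀ j, W j)))) with hC
  set U := {c : C | (Polarization.pi Q).centralizerAdjoint K c * c = 1} with hU'
  -- work inside `End_K(K ⊗ Π_j W_j)` with `A := K[val '' U]`
  set A := Algebra.adjoin K (Subtype.val '' U) with hA
  have h2 : (2 : K) ≠ 0 := by
    rw [show (2 : K) = algebraMap ℚ K 2 by norm_num]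
    exact (map_ne_zero (algebraMap ℚ K)).2 two_ne_zero
  -- (1) the unitaries `⊕ (mulSingle j u)` lie in `A`
  have hms : ∀ (j : ι) (u : Module.End K (K ⊗[ℚ] W j)),
      u ∈ Subalgebra.centralizer K ((fun a : Module.End ℚ (W j) ↦ a.baseChange K) ''
        ((H j).endAlg : Set (Module.End ℚ (W j)))) →
      (Q j).adjointBaseChange K u * u = 1 → piBlockDiagEnd K W (Pi.mulSingle j u) ∈ A := by
    intro j u huC hu
    refine Algebra.subset_adjoin ⟨⟨_, piBlockDiagEnd_mulSingle_mem_centralizer_endAlg_pi_baseChange K h0 huC⟩, ?_, rfl⟩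
    rw [hU', Set.mem_setOf_eq]
    exact Subtype.ext (by
      rw [Subalgebra.coe_mul, Polarization.coe_centralizerAdjoint, Subalgebra.coe_one]
      exact Polarization.adjointBaseChange_pi_piBlockDiagEnd_mulSingle_mul_self K hu)
  -- (2) the idempotents `⊕ (single j 1) = (in_j)_K (pr_j)_K` lie in `A`: with the unitary `u₋ = (-1) • 1` at `j`,
  --     `single j 1 = ½ (1 + (-1) • mulSingle j u₋)` (spelled with scalars to stay inside the `K`-module structure)
  have hs1 : ∀ j : ι, piBlockDiagEnd K W (Pi.single j 1) ∈ A := by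
    intro j
    have hneg1C : ((-1 : K) • (1 : Module.End K (K ⊗[ℚ] W j))) ∈ Subalgebra.centralizer K
        ((fun a : Module.End ℚ (W j) ↦ a.baseChange K) '' ((H j).endAlg : Set (Module.End ℚ (W j)))) :=
      Subalgebra.smul_mem _ (Subalgebra.one_mem _) _
    have hneg1U : (Q j).adjointBaseChange K ((-1 : K) • (1 : Module.End K (K ⊗[ℚ] W j))) *
        ((-1 : K) • (1 : Module.End K (K ⊗[ℚ] W j))) = 1 := by
      rw [(Q j).adjointBaseChange_smul K, (Q j).adjointBaseChange_one K, smul_mul_assoc, one_mul, smul_smul,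
        neg_mul_neg, one_mul, one_smul]
    have h : (Pi.single j (1 : Module.End K (K ⊗[ℚ] W j)) : ∀ i, Module.End K (K ⊗[ℚ] W i)) =
        (2 : K)⁻¹ • ((1 : ∀ i, Module.End K (K ⊗[ℚ] W i)) +
          (-1 : K) • (Pi.mulSingle j ((-1 : K) • (1 : Module.End K (K ⊗[ℚ] W j))) :
            ∀ i, Module.End K (K ⊗[ℚ] W i))) := by
      funext i
      rw [Pi.smul_apply, Pi.add_apply, Pi.smul_apply, Pi.one_apply]
      rcases eq_or_ne i j with rfl | hij
      · rw [Pi.single_eq_same, Pi.mulSingle_eq_same, smul_smul, neg_mul_neg, one_mul, one_smul,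
          ← two_smul K (1 : Module.End K (K ⊗[ℚ] W i)), smul_smul, inv_mul_cancel₀ h2, one_smul]
      · rw [Pi.single_eq_of_ne hij, Pi.mulSingle_eq_of_ne hij]
        calc (0 : Module.End K (K ⊗[ℚ] W i))
            = (2 : K)⁻¹ • (((1 : K) + (-1 : K)) • (1 : Module.End K (K ⊗[ℚ] W i))) := by
              rw [add_neg_cancel, zero_smul, smul_zero]
          _ = (2 : K)⁻¹ • ((1 : Module.End K (K ⊗[ℚ] W i)) + (-1 : K) • (1 : Module.End K (K ⊗[ℚ] W i))) := by
              rw [add_smul, one_smul]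
    rw [h, ← piBlockDiagEndAlgHom_apply, map_smul, map_add, map_one, map_smul, piBlockDiagEndAlgHom_apply]
    exact A.smul_mem (A.add_mem A.one_mem (A.smul_mem (hms j _ hneg1C hneg1U) _)) _
  -- (3) every `(in_j)_K x (pr_j)_K`, `x ∈ C(H_j)(K)`, lies in `A`
  have hsingle : ∀ (j : ι) (x : Subalgebra.centralizer K ((fun a : Module.End ℚ (W j) ↦ a.baseChange K) ''
      ((H j).endAlg : Set (Module.End ℚ (W j))))),
      piBlockDiagEnd K W (Pi.single j (x : Module.End K (K ⊗[ℚ] W j))) ∈ A := by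
    intro j
    let T : Subalgebra K (Subalgebra.centralizer K ((fun a : Module.End ℚ (W j) ↦ a.baseChange K) ''
        ((H j).endAlg : Set (Module.End ℚ (W j))))) :=
      { carrier := {x | piBlockDiagEnd K W (Pi.single j (x : Module.End K (K ⊗[ℚ] W j))) ∈ A}
        mul_mem' := fun {a b} ha hb ↦ by
          change piBlockDiagEnd K W (Pi.single j ((a : Module.End K (K ⊗[ℚ] W j)) * b)) ∈ A
          rw [Pi.single_mul, piBlockDiagEnd_mul]
          exact A.mul_mem ha hb
        one_mem' := hs1 j
        add_mem' := fun {a b} ha hb ↦ by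
          change piBlockDiagEnd K W (Pi.single j ((a : Module.End K (K ⊗[ℚ] W j)) + b)) ∈ A
          rw [Pi.single_add, ← piBlockDiagEndAlgHom_apply, map_add]
          exact A.add_mem ha hb
        zero_mem' := by
          change piBlockDiagEnd K W (Pi.single j (0 : Module.End K (K ⊗[ℚ] W j))) ∈ A
          rw [Pi.single_zero, ← piBlockDiagEndAlgHom_apply, map_zero]
          exact A.zero_mem
        algebraMap_mem' := fun k ↦ by
          change piBlockDiagEnd K W (Pi.single j (algebraMap K (Module.End K (K ⊗[ℚ] W j)) k)) ∈ A
          rw [Algebra.algebraMap_eq_smul_one, Pi.single_smul, ← piBlockDiagEndAlgHom_apply, map_smul]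
          exact A.smul_mem (hs1 j) k }
    have hTU : {c | (Q j).centralizerAdjoint K c * c = 1} ⊆ (T : Set _) := fun u hu ↦ by
      change piBlockDiagEnd K W (Pi.single j (u : Module.End K (K ⊗[ℚ] W j))) ∈ A
      have hu' : (Q j).adjointBaseChange K (u : Module.End K (K ⊗[ℚ] W j)) * u = 1 := by
        have h := congr_arg Subtype.val hu
        rwa [Subalgebra.coe_mul, Polarization.coe_centralizerAdjoint, Subalgebra.coe_one] at h
      have h : (Pi.single j (u : Module.End K (K ⊗[ℚ] W j)) : ∀ i, Module.End K (K ⊗[ℚ] W i)) =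
          Pi.mulSingle j (u : Module.End K (K ⊗[ℚ] W j)) * Pi.single j 1 := by
        funext i
        rw [Pi.mul_apply]
        rcases eq_or_ne i j with rfl | hij
        · rw [Pi.single_eq_same, Pi.mulSingle_eq_same, Pi.single_eq_same, mul_one]
        · rw [Pi.single_eq_of_ne hij, Pi.mulSingle_eq_of_ne hij, Pi.single_eq_of_ne hij, mul_zero]
      rw [h, piBlockDiagEnd_mul]
      exact A.mul_mem (hms j _ u.2 hu') (hs1 j)
    have hT : T = ⊤ := top_le_iff.1 ((hU j).symm.le.trans (Algebra.adjoin_le hTU))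
    intro x
    have hx : x ∈ T := hT ▸ Algebra.mem_top
    exact hx
  -- (4) every `c ∈ C(⊕_j H_j)(K)` is `Σ_j ⊕ (single j c_j)`
  have hall : ∀ c : C, (c : Module.End K (K ⊗[ℚ] (∀ j, W j))) ∈ A := by
    intro c
    rw [eq_piBlockDiagEnd_of_mem_centralizer_endAlg_pi_baseChange K c.2, ← Finset.univ_sum_single (fun j ↦
      (LinearMap.proj j : (∀ k, W k) →ₗ[ℚ] W j).baseChange K ∘ₗ (c : Module.End K (K ⊗[ℚ] (∀ j, W j))) ∘ₗ
        (LinearMap.single ℚ W j).baseChange K), ← piBlockDiagEndAlgHom_apply, map_sum]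
    exact A.sum_mem fun j _ ↦
      hsingle j ⟨_, block_mem_centralizer_endAlg_baseChange_of_mem_centralizer_endAlg_pi_baseChange K c.2 j⟩
  -- conclusion: `A = (adjoin K U).map val`, so `adjoin K U = ⊤`
  refine eq_top_iff.2 fun c _ ↦ ?_
  have hmap : (Algebra.adjoin K U).map C.val = A := AlgHom.map_adjoin _ _
  obtain ⟨c', hc', hcc'⟩ := Subalgebra.mem_map.1 (hmap ▸ hall c : C.val c ∈ (Algebra.adjoin K U).map C.val)
  exact Subtype.val_injective hcc' ▸ hc'

/-- **"The `k`-algebra `C(A)` is generated by the `γ ∈ S(A)(k)`" passes to `Hom`-orthogonal direct sums**: if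
`K[S(H_j)(K)] = C(H_j)(K)` for every `j`, then `K[S(⊕_j H_j)(K)] = C(⊕_j H_j)(K)` for the direct-sum polarization — with the
seat's g23-#5 (type IV pairs case) and g24-#1 (types I/II/III) this gives Milne's sentence on `K`-points for every polarized
Hodge structure that is a `Hom`-orthogonal sum of such summands (isogeny factors `A ~ ∏ Aᵢ`, Proposition 1.1).
[cite: Milne1999LefschetzClasses, §3 p. 653 L42–L46 with §1 Proposition 1.1 (p. 643)] -/
theorem Polarization.adjoin_coe_lefschetzGroupBaseChange_pi_eq_centralizer
    (h0 : ∀ i j, i ≠ j → ∀ φ : Hom (H j) (H i), φ.toLinearMap = 0)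
    (hS : ∀ j, Algebra.adjoin K ((fun γ : (K ⊗[ℚ] W j) ≃ₗ[K] (K ⊗[ℚ] W j) ↦ (γ : Module.End K (K ⊗[ℚ] W j))) ''
        ((Q j).lefschetzGroupBaseChange K : Set _)) =
      Subalgebra.centralizer K ((fun a : Module.End ℚ (W j) ↦ a.baseChange K) '' ((H j).endAlg : Set (Module.End ℚ (W j))))) :
    Algebra.adjoin K ((fun γ : (K ⊗[ℚ] (∀ j, W j)) ≃ₗ[K] (K ⊗[ℚ] (∀ j, W j)) ↦
        (γ : Module.End K (K ⊗[ℚ] (∀ j, W j)))) '' ((Polarization.pi Q).lefschetzGroupBaseChange K : Set _)) =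
      Subalgebra.centralizer K ((fun a : Module.End ℚ (∀ j, W j) ↦ a.baseChange K) ''
        ((HodgeStructure.pi H).endAlg : Set (Module.End ℚ (∀ j, W j)))) :=
  ((Polarization.pi Q).adjoin_setOf_centralizerAdjoint_mul_self_eq_one_eq_top_iff K).1
    (Polarization.adjoin_setOf_centralizerAdjoint_mul_self_eq_one_pi_eq_top K h0 fun j ↦
      ((Q j).adjoin_setOf_centralizerAdjoint_mul_self_eq_one_eq_top_iff K).2 (hS j))

end Generation

/-! ## §7 Powers: "the diagonal action of `C(A)` on `rV(A)` identifies `C(A)` with `C(A^r)`" on `K`-points —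
`C(H₀^{⊕ι})(K) = Δ C(H₀)(K)`, with the involution, and `K[S] = C` passes to powers -/

section Powers

variable {W Q} {V : Type u} [AddCommGroup V] [Module ℚ V] {H₀ : HodgeStructure V n} (Q₀ : Polarization H₀)

/-- The Hodge endomorphism `in_i pr_j` of `H₀^{⊕ι}` (the identity `H₀ → H₀` placed in block `(i, j)`). [cite: DeligneHodgeII1971, 2.1] -/
theorem single_comp_proj_mem_endAlg_pi_const (i j : ι) :
    LinearMap.single ℚ (fun _ : ι ↦ V) i ∘ₗ (LinearMap.proj j : (ι → V) →ₗ[ℚ] V) ∈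
      (HodgeStructure.pi fun _ : ι ↦ H₀).endAlg := by
  have h := single_comp_hom_comp_proj_mem_endAlg_pi (fun _ : ι ↦ H₀) (i := i) (j := j)
    (endAlg.toHom ⟨1, Subalgebra.one_mem H₀.endAlg⟩)
  rwa [show (endAlg.toHom ⟨1, Subalgebra.one_mem H₀.endAlg⟩ : Hom H₀ H₀).toLinearMap = LinearMap.id from rfl,
    LinearMap.id_comp] at h

/-- **All diagonal blocks of `c ∈ C(H₀^{⊕ι})(K)` agree** (`c` commutes with `(in_i pr_j)_K`).
[cite: Milne1999LefschetzClasses, §1 p. 643 L12–L14 ("the diagonal action of C(A) on rV(A) identifies C(A) with C(A^r)") and Remark 1.6] -/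
theorem block_eq_block_of_mem_centralizer_endAlg_pi_const_baseChange {c : Module.End K (K ⊗[ℚ] (ι → V))}
    (hc : c ∈ Subalgebra.centralizer K ((fun a : Module.End ℚ (ι → V) ↦ a.baseChange K) ''
      ((HodgeStructure.pi fun _ : ι ↦ H₀).endAlg : Set (Module.End ℚ (ι → V))))) (i j : ι) :
    (LinearMap.proj j : (ι → V) →ₗ[ℚ] V).baseChange K ∘ₗ c ∘ₗ (LinearMap.single ℚ (fun _ : ι ↦ V) j).baseChange K =
      (LinearMap.proj i : (ι → V) →ₗ[ℚ] V).baseChange K ∘ₗ c ∘ₗ (LinearMap.single ℚ (fun _ : ι ↦ V) i).baseChange K := by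
  refine LinearMap.ext fun z ↦ ?_
  have h := LinearMap.congr_fun (baseChange_mul_eq_of_mem_centralizer K hc (single_comp_proj_mem_endAlg_pi_const i j))
    ((LinearMap.single ℚ (fun _ : ι ↦ V) j).baseChange K z)
  simp only [Module.End.mul_apply, LinearMap.baseChange_comp, LinearMap.coe_comp, Function.comp_apply,
    proj_baseChange_single_baseChange_eq_self] at h
  -- `h : (in_i)_K ((pr_j)_K (c ((in_j)_K z))) = c ((in_i)_K z)`
  rw [LinearMap.comp_apply, LinearMap.comp_apply, LinearMap.comp_apply, LinearMap.comp_apply, ← h,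
    proj_baseChange_single_baseChange_eq_self]

/-- **`Δ c₀ = ⊕_j c₀ ∈ C(H₀^{⊕ι})(K)` for `c₀ ∈ C(H₀)(K)`** (every block of a Hodge endomorphism of `H₀^{⊕ι}` is a Hodge
endomorphism of `H₀`). [cite: Milne1999LefschetzClasses, §1 p. 643 L12–L14 and Remark 1.6] -/
theorem piBlockDiagEnd_const_mem_centralizer_endAlg_pi_const_baseChange {c₀ : Module.End K (K ⊗[ℚ] V)}
    (hc₀ : c₀ ∈ Subalgebra.centralizer K ((fun a : Module.End ℚ V ↦ a.baseChange K) '' (H₀.endAlg : Set (Module.End ℚ V)))) :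
    piBlockDiagEnd K (fun _ : ι ↦ V) (fun _ ↦ c₀) ∈ Subalgebra.centralizer K ((fun a : Module.End ℚ (ι → V) ↦ a.baseChange K) ''
      ((HodgeStructure.pi fun _ : ι ↦ H₀).endAlg : Set (Module.End ℚ (ι → V)))) := by
  rw [Subalgebra.mem_centralizer_iff]
  rintro _ ⟨a, ha, rfl⟩
  dsimp only
  rw [baseChange_eq_sum_blocks K a, Finset.sum_mul, Finset.mul_sum]
  refine Finset.sum_congr rfl fun i _ ↦ ?_
  rw [Finset.sum_mul, Finset.mul_sum]
  refine Finset.sum_congr rfl fun j _ ↦ ?_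
  obtain ⟨φ, hφ⟩ := exists_hom_toLinearMap_eq_block (fun _ : ι ↦ H₀) ha i j
  have hcomm := baseChange_mul_eq_of_mem_centralizer K hc₀ (Hom.toLinearMap_mem_endAlg φ)
  rw [hφ] at hcomm
  refine LinearMap.ext fun x ↦ ?_
  have hcx := LinearMap.congr_fun hcomm ((LinearMap.proj j : (ι → V) →ₗ[ℚ] V).baseChange K x)
  simp only [Module.End.mul_apply, LinearMap.comp_apply] at hcx ⊢
  rw [piBlockDiagEnd_single_baseChange_apply, proj_baseChange_piBlockDiagEnd_apply, hcx]

/-- **`C(H₀^{⊕ι})(K) = Δ C(H₀)(K)`**: for `ι` non-empty, `c ∈ C(H₀^{⊕ι})(K)` iff `c = ⊕_j c₀` with `c₀ ∈ C(H₀)(K)`.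
[cite: Milne1999LefschetzClasses, §1 p. 643 L12–L14 ("V(A^r) = rV(A), and the diagonal action of C(A) on rV(A) identifies C(A) with C(A^r)") and Remark 1.6] -/
theorem mem_centralizer_endAlg_pi_const_baseChange_iff [Nonempty ι] (c : Module.End K (K ⊗[ℚ] (ι → V))) :
    c ∈ Subalgebra.centralizer K ((fun a : Module.End ℚ (ι → V) ↦ a.baseChange K) ''
        ((HodgeStructure.pi fun _ : ι ↦ H₀).endAlg : Set (Module.End ℚ (ι → V)))) ↔
      ∃ c₀ ∈ Subalgebra.centralizer K ((fun a : Module.End ℚ V ↦ a.baseChange K) '' (H₀.endAlg : Set (Module.End ℚ V))),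
        c = piBlockDiagEnd K (fun _ : ι ↦ V) fun _ ↦ c₀ := by
  obtain ⟨i₀⟩ := ‹Nonempty ι›
  constructor
  · intro hc
    refine ⟨_, block_mem_centralizer_endAlg_baseChange_of_mem_centralizer_endAlg_pi_baseChange K (H := fun _ : ι ↦ H₀) hc i₀, ?_⟩
    conv_lhs => rw [eq_piBlockDiagEnd_of_mem_centralizer_endAlg_pi_baseChange K hc]
    exact congr_arg _ (funext fun j ↦ block_eq_block_of_mem_centralizer_endAlg_pi_const_baseChange K hc i₀ j)
  · rintro ⟨c₀, hc₀, rfl⟩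
    exact piBlockDiagEnd_const_mem_centralizer_endAlg_pi_const_baseChange K hc₀

/-- `c₀ ↦ ⊕_j c₀` is injective for `ι` non-empty. [cite: Milne1999LefschetzClasses, §1 p. 643 L12–L14] -/
theorem piBlockDiagEnd_const_injective [Nonempty ι] :
    Function.Injective fun c₀ : Module.End K (K ⊗[ℚ] V) ↦ piBlockDiagEnd K (fun _ : ι ↦ V) fun _ ↦ c₀ := by
  obtain ⟨i₀⟩ := ‹Nonempty ι›
  intro c c' h
  exact congr_fun (piBlockDiagEnd_injective K h) i₀

variable (H₀) in
/-- **`C(H₀)(K) ≃ₐ[K] C(H₀^{⊕ι})(K)`, `c₀ ↦ Δ c₀ = ⊕_j c₀`** ("the diagonal action of `C(A)` on `rV(A)` identifies `C(A)` with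
`C(A^r)`", on `K`-points; the companion of the seat's `centralizerPiConstAlgEquiv` for `k = ℚ` and of
`Polarization.lefschetzGroupBaseChangePiConstMulEquiv` for `S`). [cite: Milne1999LefschetzClasses, §1 p. 643 L12–L14 and Remark 1.6 (p. 644)] -/
def centralizerBaseChangePiConstAlgEquiv [Nonempty ι] :
    Subalgebra.centralizer K ((fun a : Module.End ℚ V ↦ a.baseChange K) '' (H₀.endAlg : Set (Module.End ℚ V))) ≃ₐ[K]
      Subalgebra.centralizer K ((fun a : Module.End ℚ (ι → V) ↦ a.baseChange K) ''
        ((HodgeStructure.pi fun _ : ι ↦ H₀).endAlg : Set (Module.End ℚ (ι → V)))) :=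
  AlgEquiv.ofBijective
    { toFun := fun c₀ ↦ ⟨piBlockDiagEnd K (fun _ : ι ↦ V) fun _ ↦ (c₀ : Module.End K (K ⊗[ℚ] V)),
        piBlockDiagEnd_const_mem_centralizer_endAlg_pi_const_baseChange K c₀.2⟩
      map_one' := Subtype.ext (piBlockDiagEnd_one K)
      map_mul' := fun c d ↦ Subtype.ext (piBlockDiagEnd_mul K _ _)
      map_zero' := Subtype.ext (by simp [piBlockDiagEnd])
      map_add' := fun c d ↦ Subtype.ext (map_add (piBlockDiagEndAlgHom K fun _ : ι ↦ V) _ _)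
      commutes' := fun k ↦ Subtype.ext ((piBlockDiagEndAlgHom K fun _ : ι ↦ V).commutes k) }
    ⟨fun c c' h ↦ Subtype.ext (piBlockDiagEnd_const_injective K (congr_arg Subtype.val h)),
      fun c ↦ by
        obtain ⟨c₀, hc₀, hc⟩ := (mem_centralizer_endAlg_pi_const_baseChange_iff K (c : Module.End K (K ⊗[ℚ] (ι → V)))).1 c.2
        exact ⟨⟨c₀, hc₀⟩, Subtype.ext hc.symm⟩⟩

/-- `(Δ c₀ : End) = ⊕_j c₀`. [cite: Milne1999LefschetzClasses, §1 p. 643 L12–L14] -/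
@[simp] theorem coe_centralizerBaseChangePiConstAlgEquiv_apply [Nonempty ι]
    (c₀ : Subalgebra.centralizer K ((fun a : Module.End ℚ V ↦ a.baseChange K) '' (H₀.endAlg : Set (Module.End ℚ V)))) :
    ((centralizerBaseChangePiConstAlgEquiv K (ι := ι) H₀ c₀ : Subalgebra.centralizer K
        ((fun a : Module.End ℚ (ι → V) ↦ a.baseChange K) '' ((HodgeStructure.pi fun _ : ι ↦ H₀).endAlg :
          Set (Module.End ℚ (ι → V))))) : Module.End K (K ⊗[ℚ] (ι → V))) =
      piBlockDiagEnd K (fun _ : ι ↦ V) fun _ ↦ (c₀ : Module.End K (K ⊗[ℚ] V)) :=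
  rfl

variable [Module.Finite ℚ V]

/-- **"as `k`-algebras with involution"**: `(Δ c₀)† = Δ (c₀†)` for the power polarization `⊕_j Q₀`.
[cite: Milne1999LefschetzClasses, §1 p. 643 L12–L14 ("identifies C(A) with C(A^r) (as k-algebras with involution)")] -/
theorem Polarization.centralizerBaseChangePiConstAlgEquiv_centralizerAdjoint [Nonempty ι]
    (c₀ : Subalgebra.centralizer K ((fun a : Module.End ℚ V ↦ a.baseChange K) '' (H₀.endAlg : Set (Module.End ℚ V)))) :
    (Polarization.pi fun _ : ι ↦ Q₀).centralizerAdjoint K (centralizerBaseChangePiConstAlgEquiv K (ι := ι) H₀ c₀) =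
      centralizerBaseChangePiConstAlgEquiv K (ι := ι) H₀ (Q₀.centralizerAdjoint K c₀) :=
  Subtype.ext (by
    rw [Polarization.coe_centralizerAdjoint, coe_centralizerBaseChangePiConstAlgEquiv_apply,
      coe_centralizerBaseChangePiConstAlgEquiv_apply, Polarization.adjointBaseChange_pi_piBlockDiagEnd,
      Polarization.coe_centralizerAdjoint])

/-- **Milne's Lemma 3.5 passes to powers**: if `(C(H₀)(K), †)` is generated by its unitary elements, so is
`(C(H₀^{⊕ι})(K), †)` (transport along `Δ`, which matches the unitary elements). [cite: Milne1999LefschetzClasses, §1 p. 643 L12–L14 and §3 proof of Lemma 3.5 (p. 653 L47 – p. 654 L6)] -/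
theorem Polarization.adjoin_setOf_centralizerAdjoint_mul_self_eq_one_pi_const_eq_top [Nonempty ι]
    (hU : Algebra.adjoin K {c : Subalgebra.centralizer K ((fun a : Module.End ℚ V ↦ a.baseChange K) ''
      (H₀.endAlg : Set (Module.End ℚ V))) | Q₀.centralizerAdjoint K c * c = 1} = ⊤) :
    Algebra.adjoin K {c : Subalgebra.centralizer K ((fun a : Module.End ℚ (ι → V) ↦ a.baseChange K) ''
      ((HodgeStructure.pi fun _ : ι ↦ H₀).endAlg : Set (Module.End ℚ (ι → V)))) |
        (Polarization.pi fun _ : ι ↦ Q₀).centralizerAdjoint K c * c = 1} = ⊤ := by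
  set Δ := centralizerBaseChangePiConstAlgEquiv K (ι := ι) H₀ with hΔ
  have himage : (Δ : _ → _) '' {c | Q₀.centralizerAdjoint K c * c = 1} =
      {c | (Polarization.pi fun _ : ι ↦ Q₀).centralizerAdjoint K c * c = 1} := by
    ext c
    constructor
    · rintro ⟨c₀, hc₀, rfl⟩
      rw [Set.mem_setOf_eq, hΔ, Polarization.centralizerBaseChangePiConstAlgEquiv_centralizerAdjoint, ← map_mul,
        (hc₀ : Q₀.centralizerAdjoint K c₀ * c₀ = 1), map_one]
    · intro hc
      refine ⟨Δ.symm c, ?_, Δ.apply_symm_apply c⟩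
      rw [Set.mem_setOf_eq, ← Δ.injective.eq_iff, map_mul, map_one, hΔ,
        ← Polarization.centralizerBaseChangePiConstAlgEquiv_centralizerAdjoint, ← hΔ, Δ.apply_symm_apply]
      exact hc
  have hmap := congr_arg (Subalgebra.map Δ.toAlgHom) hU
  rw [AlgHom.map_adjoin, Algebra.map_top] at hmap
  change Algebra.adjoin K ((Δ : _ → _) '' _) = _ at hmap
  rw [himage] at hmap
  rw [hmap]
  exact (AlgHom.range_eq_top _).2 Δ.surjective

/-- **"The `k`-algebra `C(A)` is generated by the `γ ∈ S(A)(k)`" passes to powers**: `K[S(H₀)(K)] = C(H₀)(K)` implies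
`K[S(H₀^{⊕ι})(K)] = C(H₀^{⊕ι})(K)` (isogeny factors `A ~ ∏ Aᵢ^{rᵢ}`). [cite: Milne1999LefschetzClasses, §3 p. 653 L42–L46 with §1 p. 643 L12–L14 and Proposition 1.1] -/
theorem Polarization.adjoin_coe_lefschetzGroupBaseChange_pi_const_eq_centralizer [Nonempty ι]
    (hS : Algebra.adjoin K ((fun γ : (K ⊗[ℚ] V) ≃ₗ[K] (K ⊗[ℚ] V) ↦ (γ : Module.End K (K ⊗[ℚ] V))) ''
        (Q₀.lefschetzGroupBaseChange K : Set _)) =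
      Subalgebra.centralizer K ((fun a : Module.End ℚ V ↦ a.baseChange K) '' (H₀.endAlg : Set (Module.End ℚ V)))) :
    Algebra.adjoin K ((fun γ : (K ⊗[ℚ] (ι → V)) ≃ₗ[K] (K ⊗[ℚ] (ι → V)) ↦ (γ : Module.End K (K ⊗[ℚ] (ι → V)))) ''
        ((Polarization.pi fun _ : ι ↦ Q₀).lefschetzGroupBaseChange K : Set _)) =
      Subalgebra.centralizer K ((fun a : Module.End ℚ (ι → V) ↦ a.baseChange K) ''
        ((HodgeStructure.pi fun _ : ι ↦ H₀).endAlg : Set (Module.End ℚ (ι → V)))) :=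
  ((Polarization.pi fun _ : ι ↦ Q₀).adjoin_setOf_centralizerAdjoint_mul_self_eq_one_eq_top_iff K).1
    (Polarization.adjoin_setOf_centralizerAdjoint_mul_self_eq_one_pi_const_eq_top K Q₀
      ((Q₀.adjoin_setOf_centralizerAdjoint_mul_self_eq_one_eq_top_iff K).2 hS))

end Powers

end HodgeStructure

end Literature.AlgebraicGeometry.Motives

end
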